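import Mathlib
import HarnessLib
import Summits.ValiantsHypothesis.ValiantsHypothesis.Theses.MonotoneRestoration
import Literature.Computability.AlgebraicComplexity.ArithCircuit
import Literature.Computability.AlgebraicComplexity.ArithCircuitProofs
import Literature.Computability.AlgebraicComplexity.MonotoneStructure
import Literature.Computability.AlgebraicComplexity.PermanentIrreducible
import Literature.ModelTheory.FiniteModelTheory.CkEquiv
import Summits.ValiantsHypothesis.ValiantsHypothesis.Theorems.MonotoneRestorationMonotoneRestorationQPCosetCount
import Summits.ValiantsHypothesis.ValiantsHypothesis.Theorems.MonotoneRestorationMonotoneRestorationQPSymmetricLB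
import Summits.ValiantsHypothesis.ValiantsHypothesis.Theorems.MonotoneRestorationMonotoneRestorationQPSupportSymmetrisation
import Summits.ValiantsHypothesis.ValiantsHypothesis.Theorems.MonotoneRestorationMonotoneRestorationQPSparseRegime
import Summits.ValiantsHypothesis.ValiantsHypothesis.Theorems.MonotoneRestorationMonotoneRestorationQPBeta
import Literature.Computability.AlgebraicComplexity.SymmetricArithCircuit
import Literature.Computability.AlgebraicComplexity.DawarWilsenach2025Proofs
import Literature.GroupTheory.PermutationGroups.SmallIndexSubgroups
import Summits.ValiantsHypothesis.ValiantsHypothesis.Theorems.MonotoneRestorationQP.Negative.LoadBearing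
import Summits.ValiantsHypothesis.ValiantsHypothesis.Theorems.MonotoneRestorationMonotoneRestorationQPPermSupportCount

/-! TTRL-lite variant V18959 of stmt-ValiantsHypothesis-15886 -/

-- `Summit.ValiantsHypothesis.ValiantsHypothesis.…` is the tree's mandated single-conjunct layout
-- (Sub = Summit), so the duplicated namespace component is intended.
set_option linter.dupNamespace false

namespace Summit.ValiantsHypothesis.ValiantsHypothesis.Theorems

open Summit.ValiantsHypothesis.ValiantsHypothesis.Theses.MonotoneRestoration
open Literature.Computability.AlgebraicComplexity

/-- TTRL-lite variant V18959 (small case `n = 1`, `p = q = X (0,0)`, `f = X (0,0) * X (0,0)`, `μ = 0`) of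
`stub_mulGate_children_extend` is FALSE: `Finsupp.single (0,0) 1` is the unique monomial of `X (0,0)`,
but the unique monomial of `X (0,0) * X (0,0)` is `Finsupp.single (0,0) 2`. -/
theorem stub_mulGate_children_extend_var18959_false :
    ¬ (∀ m ∈ (MvPolynomial.X ((0 : Fin 1), (0 : Fin 1)) : MvPolynomial (Fin 1 × Fin 1) NNReal).support,
        m + 0 ∈ ((MvPolynomial.X ((0 : Fin 1), (0 : Fin 1)) * MvPolynomial.X ((0 : Fin 1), (0 : Fin 1)) :
          MvPolynomial (Fin 1 × Fin 1) NNReal)).support) := by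
  intro h
  have hX : (Finsupp.single ((0 : Fin 1), (0 : Fin 1)) 1 : Fin 1 × Fin 1 →₀ ℕ) ∈
      (MvPolynomial.X ((0 : Fin 1), (0 : Fin 1)) : MvPolynomial (Fin 1 × Fin 1) NNReal).support := by
    rw [MvPolynomial.support_X]
    exact Finset.mem_singleton_self _
  have hmul : ((MvPolynomial.X ((0 : Fin 1), (0 : Fin 1)) * MvPolynomial.X ((0 : Fin 1), (0 : Fin 1)) :
          MvPolynomial (Fin 1 × Fin 1) NNReal)).support =
        {Finsupp.single ((0 : Fin 1), (0 : Fin 1)) 2} := by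
    have hx2 : (MvPolynomial.X ((0 : Fin 1), (0 : Fin 1)) * MvPolynomial.X ((0 : Fin 1), (0 : Fin 1)) :
          MvPolynomial (Fin 1 × Fin 1) NNReal) =
        MvPolynomial.monomial (Finsupp.single ((0 : Fin 1), (0 : Fin 1)) 2) 1 := by
      rw [← sq, MvPolynomial.X_pow_eq_monomial]
    rw [hx2, MvPolynomial.support_monomial, if_neg one_ne_zero]
  have h1 := h _ hX
  rw [add_zero, hmul, Finset.mem_singleton] at h1
  have h2 := congrArg (fun g : Fin 1 × Fin 1 →₀ ℕ => g ((0 : Fin 1), (0 : Fin 1))) h1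
  simp only [Finsupp.single_eq_same] at h2
  omega

end Summit.ValiantsHypothesis.ValiantsHypothesis.Theorems
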